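import Literature.NumberTheory.GaloisRepresentations.NearlyOrdinaryPresentationProofs
import Literature.NumberTheory.GaloisRepresentations.NearlyOrdinaryLiftAssembly
import HarnessLib

/-!
# `NearlyOrdinaryPresentation` from Galois lifts of `ρ_𝒟 mod 𝔪ⁿ`

Topic `Literature/NumberTheory/GaloisRepresentations`.  This file plugs Mazur's obstruction
calculus (`DeformationLiftingObstruction`, `DeformationLocalObstruction`, `LiftTorsor`,
`NearlyOrdinaryLiftAssembly`) and the universality step (`NearlyOrdinaryLiftSection`) into the
ring-theoretic reduction `NearlyOrdinaryPresentationProofs.nearlyOrdinaryPresentation_of_obstruction`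
of the cited record `NearlyOrdinaryPresentation` (Böckle 2007, Thm. 7.6):

* `mvPowerSeriesCNL` — `𝒪⟦T₁, …, T_m⟧` as an object of `Ĉ_𝒪(k)`;
* `truncEquiv` — for a surjection `Θ : P ↠ R` of local `𝒪`-algebras,
  `P/(ker Θ + 𝔪_Pⁿ) ≃ₐ[𝒪] R/𝔪_Rⁿ`;
* `Bu`, `qu` — the pushed-out Artinian objects `B_u = 𝒪⟦T⟧/(J_u + 𝔪ⁿ)` of `Ĉ_𝒪(k)` (`n ≥ 1`) with their
  surjections `q_u : B_u ↠ R_𝒟/𝔪ⁿ` (square-zero kernel, `𝔪_{B_u}ⁿ = 0`);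
* `nearlyOrdinaryPresentation_of_lifts` — **the record for `𝓡` follows from: for every minimal
  cotangent presentation `Θ` and Artin–Rees exponent, a `κ`-linear map `ob` on `(J/𝔪J)^*` into a
  `κ`-space `O` with `dim O + 1 + [F:ℚ] ≤ h` such that `ob u = 0` yields a global lift of
  `ρ_𝒟 mod 𝔪ⁿ` to `B_u` (open kernel, unramified outside `S`), upper-triangular local lifts at
  `v ∣ p`, and secondary splittings** — i.e. the remaining input is exactly the construction of
  `ob` from the obstruction classes together with the cohomological dimension count
  (Poitou–Tate, Tate's local and global Euler characteristic formulae).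

Everything here is proved; no named facts.

## References

* G. Böckle, *Presentations of universal deformation rings*, LMS LNS 320 (2007), Thm. 2.2,
  Thm. 7.6. [cite: Bockle2007Presentations, Theorem 7.6]
* B. Mazur, *Deforming Galois representations*, MSRI Publ. 16 (1989), §1.6 Prop. 2.
  [cite: Mazur1989Deforming, §1.6 Prop. 2]
-/

noncomputable section

open scoped NumberField
open Field IsDedekindDomain IsLocalRing

namespace Literature.NumberTheory.GaloisRepresentations

/-! ## 0. Frames from secondary splittings (any frame lift, any section) -/

namespace NearlyOrdinaryDeformationRing

variable {F : Type} [Field F] [NumberField F] {p : ℕ} {𝒪 : Type} [CommRing 𝒪] {k : Type}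
  [Field k] [Algebra 𝒪 k] {𝒟 : NearlyOrdinaryDatum F p 𝒪 k}
  (𝓡 : NearlyOrdinaryDeformationRing.{0} 𝒟)
  {n : ℕ} {B : Type} [CommRing B] {q : B →+* 𝓡.R ⧸ maximalIdeal 𝓡.R ^ n}
  (hI : ∀ x ∈ RingHom.ker q, ∀ y ∈ RingHom.ker q, x * y = 0)

/-- `ρ_B|_{Γ_{F_v}}` in a frame `P ∈ GL₂(B)`: `σ ↦ P⁻¹ ρ_B(σ) P`. [folklore] -/
def conjLocal (P : GL (Fin 2) B) (ρB : absoluteGaloisGroup F →* GL (Fin 2) B)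
    (v : HeightOneSpectrum (𝓞 F)) : absoluteGaloisGroup (v.adicCompletion F) →* GL (Fin 2) B :=
  (MulAut.conj P⁻¹).toMonoidHom.comp (Deformation.toLocal v ρB)

/-- Unfolding `conjLocal`. [folklore] -/
theorem conjLocal_apply (P : GL (Fin 2) B) (ρB : absoluteGaloisGroup F →* GL (Fin 2) B)
    (v : HeightOneSpectrum (𝓞 F)) (σ : absoluteGaloisGroup (v.adicCompletion F)) :
    conjLocal P ρB v σ = P⁻¹ * ρB (absGaloisRestrict F (v.adicCompletion F) σ) * P := by
  rfl

/-- `conjLocal P ρ_B v` lifts `localModPow v n` when `ρ_B` lifts `ρ_𝒟 mod 𝔪ⁿ` and `P` lifts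
`noFrame v mod 𝔪ⁿ`. [folklore] -/
theorem map_conjLocal {v : HeightOneSpectrum (𝓞 F)} (P : GL (Fin 2) B)
    (hP : Matrix.GeneralLinearGroup.map q P = 𝓡.noFrameModPow v n)
    (ρB : absoluteGaloisGroup F →* GL (Fin 2) B)
    (hρB : ∀ σ, Matrix.GeneralLinearGroup.map q (ρB σ) = 𝓡.modPow n σ)
    (σ : absoluteGaloisGroup (v.adicCompletion F)) :
    Matrix.GeneralLinearGroup.map q (conjLocal P ρB v σ) = 𝓡.localModPow v n σ := by
  rw [conjLocal_apply, map_mul, map_mul, map_inv, hP, hρB, localModPow_eq_conj, modPow_apply]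

include hI in
/-- **Frames from secondary splittings.**  Let `ρ_B` be a homomorphism `Γ_F → GL₂(B)`, `P` a lift
of `noFrame v mod 𝔪ⁿ`, `s'` any set-theoretic section of `GL₂(q)`, `ρ_v` an upper-triangular
lift of `localModPow v n`, and suppose the difference cocycle of `ρ_v` and `P⁻¹ ρ_B|_{Γ_{F_v}} P`
splits as `e + (X − σ·X)` with `e` `𝔟(I)`-valued and `X ∈ M₂(I)` (`σ·X = s'(rσ) X s'(rσ)⁻¹`).
Then `ρ_B|_{Γ_{F_v}}` is upper triangular in the frame `P (1 + X)`, which again lifts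
`noFrame v mod 𝔪ⁿ` (`LiftTorsor.conj_mem_parabolicGL_of_liftDiff_eq`). [cite: Mazur1989Deforming, §1.7] -/
theorem exists_frame_of_secondary' (v : HeightOneSpectrum (𝓞 F)) (P : GL (Fin 2) B)
    (hP : Matrix.GeneralLinearGroup.map q P = 𝓡.noFrameModPow v n)
    {s' : GL (Fin 2) (𝓡.R ⧸ maximalIdeal 𝓡.R ^ n) → GL (Fin 2) B}
    (hs' : ∀ g, Matrix.GeneralLinearGroup.map q (s' g) = g)
    (ρB : absoluteGaloisGroup F →* GL (Fin 2) B)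
    (ρv : absoluteGaloisGroup (v.adicCompletion F) →* GL (Fin 2) B)
    (hρv : ∀ σ, Matrix.GeneralLinearGroup.map q (ρv σ) = 𝓡.localModPow v n σ)
    (hρvup : ∀ σ, (ρv σ : Matrix (Fin 2) (Fin 2) B) 1 0 = 0)
    (e : absoluteGaloisGroup (v.adicCompletion F) → Matrix (Fin 2) (Fin 2) B)
    (he : ∀ σ, e σ ∈ LiftingObstruction.kerParabolic (id : Fin 2 → Fin 2) q)
    (X : Matrix (Fin 2) (Fin 2) B) (hX : X ∈ LiftingObstruction.kerMatrix q)
    (hd : ∀ σ, LiftingObstruction.liftDiff ρv (conjLocal P ρB v) σ =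
      e σ + (X - (s' (𝓡.localModPow v n σ) : Matrix (Fin 2) (Fin 2) B) * X *
        ((s' (𝓡.localModPow v n σ))⁻¹ : GL (Fin 2) B))) :
    ∃ P' : GL (Fin 2) B,
      Matrix.GeneralLinearGroup.map q P' =
        Matrix.GeneralLinearGroup.map (Ideal.Quotient.mk (maximalIdeal 𝓡.R ^ n)) (𝓡.noFrame v) ∧
      ∀ σ, (P'⁻¹ * ρB (absGaloisRestrict F (v.adicCompletion F) σ) * P').val 1 0 = 0 := by
  refine ⟨P * LiftingObstruction.unitOfKer hI X hX, ?_, fun σ => ?_⟩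
  · rw [map_mul, LiftingObstruction.map_unitOfKer, mul_one, hP]
    rfl
  · have hmem := LiftingObstruction.conj_mem_parabolicGL_of_liftDiff_eq hI hs' hρv
      (id : Fin 2 → Fin 2)
      (fun σ => (LiftingObstruction.mem_parabolicGL_id_fin_two_iff _).mpr (hρvup σ)) e he X hX hd σ
    rw [LiftingObstruction.mem_parabolicGL_id_fin_two_iff, conjLocal_apply] at hmem
    have e1 : (P * LiftingObstruction.unitOfKer hI X hX)⁻¹ *
        ρB (absGaloisRestrict F (v.adicCompletion F) σ) * (P * LiftingObstruction.unitOfKer hI X hX) =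
        (LiftingObstruction.unitOfKer hI X hX)⁻¹ *
          (P⁻¹ * ρB (absGaloisRestrict F (v.adicCompletion F) σ) * P) *
          LiftingObstruction.unitOfKer hI X hX := by
      group
    rw [e1]
    exact hmem

end NearlyOrdinaryDeformationRing

namespace NearlyOrdinaryPresentationCA

/-! ## 1. `𝒪⟦T₁, …, T_m⟧` as an object of `Ĉ_𝒪(k)` -/

section CNL

variable (𝒪 : Type) [CommRing 𝒪] (k : Type) [Field k] [Algebra 𝒪 k]

/-- The constant coefficient `𝒪⟦T⟧ → 𝒪` as an `𝒪`-algebra map. [folklore] -/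
def constantCoeffₐ (m : ℕ) : MvPowerSeries (Fin m) 𝒪 →ₐ[𝒪] 𝒪 :=
  { (MvPowerSeries.constantCoeff : MvPowerSeries (Fin m) 𝒪 →+* 𝒪) with
    commutes' := fun r => by
      change MvPowerSeries.constantCoeff (algebraMap 𝒪 (MvPowerSeries (Fin m) 𝒪) r) = r
      rw [MvPowerSeries.algebraMap_apply, Algebra.algebraMap_self, RingHom.id_apply,
        MvPowerSeries.constantCoeff_C] }

/-- Unfolding `constantCoeffₐ`. [folklore] -/
@[simp] theorem constantCoeffₐ_apply (m : ℕ) (f : MvPowerSeries (Fin m) 𝒪) :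
    constantCoeffₐ 𝒪 m f = MvPowerSeries.constantCoeff f :=
  rfl

variable [IsDomain 𝒪] [IsDiscreteValuationRing 𝒪] [IsAdicComplete (maximalIdeal 𝒪) 𝒪]
  (hk : Function.Surjective (algebraMap 𝒪 k))

/-- **`𝒪⟦T₁, …, T_m⟧` as an object of `Ĉ_𝒪(k)`** (complete Noetherian local, augmentation
`f ↦ f(0) mod 𝔪_𝒪` onto `k`). [cite: Mazur1997Deformation, §2] -/
def mvPowerSeriesCNL (m : ℕ) : Deformation.CNLAlgebra 𝒪 k :=
  haveI := isNoetherianRing_mvPowerSeries_dvr 𝒪 m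
  haveI := isAdicComplete_maximalIdeal_mvPowerSeries 𝒪 m
  { carrier := MvPowerSeries (Fin m) 𝒪
    residue := (Algebra.ofId 𝒪 k).comp (constantCoeffₐ 𝒪 m)
    residue_surjective := fun x => by
      obtain ⟨o, rfl⟩ := hk x
      exact ⟨algebraMap 𝒪 _ o, by simp⟩ }

/-- The underlying type of `mvPowerSeriesCNL`. [folklore] -/
@[simp] theorem mvPowerSeriesCNL_carrier (m : ℕ) :
    ((mvPowerSeriesCNL 𝒪 k hk m : Deformation.CNLAlgebra 𝒪 k) : Type) = MvPowerSeries (Fin m) 𝒪 :=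
  rfl

end CNL

/-! ## 2. Truncating a presentation: `P/(ker Θ + 𝔪_Pⁿ) ≃ R/𝔪_Rⁿ` -/

section Trunc

variable {𝒪 : Type*} [CommRing 𝒪] {P R : Type*} [CommRing P] [CommRing R] [IsLocalRing P]
  [IsLocalRing R] [Algebra 𝒪 P] [Algebra 𝒪 R] (Θ : P →ₐ[𝒪] R) (hΘ : Function.Surjective Θ)

/-- The truncation `P → R/𝔪_Rⁿ` of `Θ`. [folklore] -/
def truncMap (n : ℕ) : P →ₐ[𝒪] R ⧸ maximalIdeal R ^ n :=
  (Ideal.Quotient.mkₐ 𝒪 (maximalIdeal R ^ n)).comp Θ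

omit [IsLocalRing P] in
/-- Unfolding `truncMap`. [folklore] -/
@[simp] theorem truncMap_apply (n : ℕ) (x : P) :
    truncMap Θ n x = Ideal.Quotient.mk (maximalIdeal R ^ n) (Θ x) :=
  rfl

omit [IsLocalRing P] in
include hΘ in
/-- `truncMap` is onto. [folklore] -/
theorem truncMap_surjective (n : ℕ) : Function.Surjective (truncMap Θ n) :=
  (Ideal.Quotient.mkₐ_surjective 𝒪 _).comp hΘ

include hΘ in
/-- A surjection of local rings maps `𝔪_Pⁿ` ONTO `𝔪_Rⁿ`. [folklore] -/
theorem map_pow_maximalIdeal_eq (n : ℕ) :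
    (maximalIdeal P ^ n).map (Θ : P →+* R) = maximalIdeal R ^ n := by
  rw [Ideal.map_pow, IsLocalRing.map_maximalIdeal_of_surjective (Θ : P →+* R) hΘ]

include hΘ in
/-- `ker (P → R/𝔪_Rⁿ) = ker Θ + 𝔪_Pⁿ`. [folklore] -/
theorem ker_truncMap (n : ℕ) :
    RingHom.ker (truncMap Θ n) = RingHom.ker Θ ⊔ maximalIdeal P ^ n := by
  ext x
  rw [RingHom.mem_ker, truncMap_apply, Ideal.Quotient.eq_zero_iff_mem]
  constructor
  · intro hx
    rw [← map_pow_maximalIdeal_eq Θ hΘ n] at hx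
    obtain ⟨m, hm, hmx⟩ := (Ideal.mem_map_iff_of_surjective (Θ : P →+* R) hΘ).mp hx
    have hk : x - m ∈ RingHom.ker Θ := by
      rw [RingHom.mem_ker, map_sub, sub_eq_zero]
      exact hmx.symm
    have e : x = (x - m) + m := by abel
    rw [e]
    exact Ideal.add_mem _ (Ideal.mem_sup_left hk) (Ideal.mem_sup_right hm)
  · intro hx
    obtain ⟨j, hj, m, hm, rfl⟩ := Submodule.mem_sup.mp hx
    rw [RingHom.mem_ker] at hj
    rw [map_add, hj, zero_add, ← map_pow_maximalIdeal_eq Θ hΘ n]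
    exact Ideal.mem_map_of_mem _ hm

/-- **`P/(ker Θ + 𝔪_Pⁿ) ≃ₐ[𝒪] R/𝔪_Rⁿ`** for a surjection `Θ : P ↠ R` of local `𝒪`-algebras.
[folklore] -/
def truncEquiv (n : ℕ) : (P ⧸ (RingHom.ker Θ ⊔ maximalIdeal P ^ n)) ≃ₐ[𝒪] R ⧸ maximalIdeal R ^ n :=
  (Ideal.quotientEquivAlgOfEq 𝒪 (ker_truncMap Θ hΘ n).symm).trans
    (Ideal.quotientKerAlgEquivOfSurjective (truncMap_surjective Θ hΘ n))

/-- `truncEquiv` on residue classes. [folklore] -/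
@[simp] theorem truncEquiv_mk (n : ℕ) (x : P) :
    truncEquiv Θ hΘ n (Ideal.Quotient.mk _ x) = Ideal.Quotient.mk (maximalIdeal R ^ n) (Θ x) := by
  rw [truncEquiv, AlgEquiv.trans_apply, Ideal.quotientEquivAlgOfEq_mk,
    Ideal.quotientKerAlgEquivOfSurjective_mk, truncMap_apply]

end Trunc

/-! ## 3. The pushed-out Artinian objects `B_u` -/

section Pushout

variable {𝒪 : Type} [CommRing 𝒪] [IsLocalRing 𝒪] {R : Type} [CommRing R] [IsLocalRing R]
  [Algebra 𝒪 R] {m : ℕ} (Θ : MvPowerSeries (Fin m) 𝒪 →ₐ[𝒪] R) (hΘ : Function.Surjective Θ)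
  (u : Module.Dual (MvPowerSeries (Fin m) 𝒪 ⧸ maximalIdeal (MvPowerSeries (Fin m) 𝒪))
    (↥(RingHom.ker Θ) ⧸
      (maximalIdeal (MvPowerSeries (Fin m) 𝒪) •
        (⊤ : Submodule (MvPowerSeries (Fin m) 𝒪) ↥(RingHom.ker Θ)))))
  (n : ℕ)

/-- The ideal `J_u + 𝔪ⁿ` of `𝒪⟦T⟧`. [cite: Mazur1989Deforming, §1.6 Prop. 2] -/
def pushoutTruncIdeal : Ideal (MvPowerSeries (Fin m) 𝒪) :=
  Literature.RingTheory.CompleteLocalRings.pushoutIdeal (RingHom.ker Θ) u ⊔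
    maximalIdeal (MvPowerSeries (Fin m) 𝒪) ^ n

/-- `J_u + 𝔪ⁿ ⊆ 𝔪` for `n ≠ 0`. [folklore] -/
theorem pushoutTruncIdeal_le_maximalIdeal (hn0 : n ≠ 0) :
    pushoutTruncIdeal Θ u n ≤ maximalIdeal (MvPowerSeries (Fin m) 𝒪) := by
  refine sup_le ?_ (Ideal.pow_le_self hn0)
  refine (Literature.RingTheory.CompleteLocalRings.pushoutIdeal_le _ u).trans ?_
  exact IsLocalRing.le_maximalIdeal (RingHom.ker_ne_top _)

/-- `J_u + 𝔪ⁿ ≠ ⊤` for `n ≠ 0`. [folklore] -/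
theorem pushoutTruncIdeal_ne_top (hn0 : n ≠ 0) : pushoutTruncIdeal Θ u n ≠ ⊤ := fun h =>
  (maximalIdeal.isMaximal (MvPowerSeries (Fin m) 𝒪)).ne_top
    (top_le_iff.mp (h ▸ pushoutTruncIdeal_le_maximalIdeal Θ u n hn0))

omit [IsLocalRing R] in
/-- `J_u + 𝔪ⁿ ⊆ J + 𝔪ⁿ`. [folklore] -/
theorem pushoutTruncIdeal_le :
    pushoutTruncIdeal Θ u n ≤ RingHom.ker Θ ⊔ maximalIdeal (MvPowerSeries (Fin m) 𝒪) ^ n :=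
  sup_le_sup_right (Literature.RingTheory.CompleteLocalRings.pushoutIdeal_le _ u) _

omit [IsLocalRing R] in
/-- `𝔪 · (J + 𝔪ⁿ) ⊆ J_u + 𝔪ⁿ` (so the kernel of `B_u ↠ R/𝔪ⁿ` is killed by `𝔪_{B_u}`).
[cite: Mazur1989Deforming, §1.6 Prop. 2] -/
theorem maximalIdeal_mul_le_pushoutTruncIdeal :
    maximalIdeal (MvPowerSeries (Fin m) 𝒪) *
        (RingHom.ker Θ ⊔ maximalIdeal (MvPowerSeries (Fin m) 𝒪) ^ n) ≤
      pushoutTruncIdeal Θ u n := by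
  rw [Ideal.mul_sup]
  refine sup_le ?_ ?_
  · exact (Literature.RingTheory.CompleteLocalRings.maximalIdeal_mul_le_pushoutIdeal _ u).trans
      le_sup_left
  · exact Ideal.mul_le_left.trans le_sup_right

/-- `(J + 𝔪ⁿ)² ⊆ J_u + 𝔪ⁿ` (`n ≠ 0`). [cite: Mazur1989Deforming, §1.6 Prop. 2] -/
theorem sup_mul_sup_le_pushoutTruncIdeal (hn0 : n ≠ 0) :
    (RingHom.ker Θ ⊔ maximalIdeal (MvPowerSeries (Fin m) 𝒪) ^ n) *
        (RingHom.ker Θ ⊔ maximalIdeal (MvPowerSeries (Fin m) 𝒪) ^ n) ≤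
      pushoutTruncIdeal Θ u n := by
  refine le_trans (Ideal.mul_mono_left ?_) (maximalIdeal_mul_le_pushoutTruncIdeal Θ u n)
  exact sup_le (IsLocalRing.le_maximalIdeal (RingHom.ker_ne_top _)) (Ideal.pow_le_self hn0)

/-- **The surjection `q_u : 𝒪⟦T⟧/(J_u + 𝔪ⁿ) ↠ R/𝔪ⁿ`** (through `𝒪⟦T⟧/(J + 𝔪ⁿ) ≅ R/𝔪ⁿ`).
[cite: Mazur1989Deforming, §1.6 Prop. 2] -/
def quRaw : (MvPowerSeries (Fin m) 𝒪 ⧸ pushoutTruncIdeal Θ u n) →ₐ[𝒪] R ⧸ maximalIdeal R ^ n :=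
  ((truncEquiv Θ hΘ n : (MvPowerSeries (Fin m) 𝒪 ⧸ (RingHom.ker Θ ⊔
      maximalIdeal (MvPowerSeries (Fin m) 𝒪) ^ n)) →ₐ[𝒪] R ⧸ maximalIdeal R ^ n)).comp
    (Ideal.Quotient.factorₐ 𝒪 (I := pushoutTruncIdeal Θ u n)
      (J := RingHom.ker Θ ⊔ maximalIdeal (MvPowerSeries (Fin m) 𝒪) ^ n)
      (pushoutTruncIdeal_le Θ u n))

/-- `q_u` on residue classes. [folklore] -/
@[simp] theorem quRaw_mk (x : MvPowerSeries (Fin m) 𝒪) :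
    quRaw Θ hΘ u n (Ideal.Quotient.mk (pushoutTruncIdeal Θ u n) x) =
      Ideal.Quotient.mk (maximalIdeal R ^ n) (Θ x) := by
  change truncEquiv Θ hΘ n
    (Ideal.Quotient.factorₐ 𝒪 (I := pushoutTruncIdeal Θ u n)
      (J := RingHom.ker Θ ⊔ maximalIdeal (MvPowerSeries (Fin m) 𝒪) ^ n)
      (pushoutTruncIdeal_le Θ u n) (Ideal.Quotient.mk _ x)) = _
  rw [Ideal.Quotient.factorₐ_apply, Ideal.Quotient.factor_mk, truncEquiv_mk]

/-- `q_u` is onto. [folklore] -/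
theorem quRaw_surjective : Function.Surjective (quRaw Θ hΘ u n) := by
  intro y
  obtain ⟨r, rfl⟩ := Ideal.Quotient.mk_surjective y
  obtain ⟨x, rfl⟩ := hΘ r
  exact ⟨Ideal.Quotient.mk _ x, quRaw_mk Θ hΘ u n x⟩

/-- `q_u (mk x) = 0 ↔ x ∈ J + 𝔪ⁿ`. [folklore] -/
theorem quRaw_mk_eq_zero_iff (x : MvPowerSeries (Fin m) 𝒪) :
    quRaw Θ hΘ u n (Ideal.Quotient.mk (pushoutTruncIdeal Θ u n) x) = 0 ↔
      x ∈ RingHom.ker Θ ⊔ maximalIdeal (MvPowerSeries (Fin m) 𝒪) ^ n := by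
  rw [quRaw_mk, ← ker_truncMap Θ hΘ n, RingHom.mem_ker, truncMap_apply]

/-- **`ker q_u` has square zero** (`n ≠ 0`). [cite: Mazur1989Deforming, §1.6 Prop. 2] -/
theorem quRaw_sqZero (hn0 : n ≠ 0) (x y : MvPowerSeries (Fin m) 𝒪 ⧸ pushoutTruncIdeal Θ u n)
    (hx : quRaw Θ hΘ u n x = 0) (hy : quRaw Θ hΘ u n y = 0) : x * y = 0 := by
  obtain ⟨a, rfl⟩ := Ideal.Quotient.mk_surjective x
  obtain ⟨b, rfl⟩ := Ideal.Quotient.mk_surjective y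
  rw [quRaw_mk_eq_zero_iff] at hx hy
  rw [← map_mul, Ideal.Quotient.eq_zero_iff_mem]
  exact sup_mul_sup_le_pushoutTruncIdeal Θ u n hn0 (Ideal.mul_mem_mul hx hy)

omit [IsLocalRing R] in
/-- **`𝔪ⁿ = 0` in `𝒪⟦T⟧/(J_u + 𝔪ⁿ)`**: elements of `𝔪_{𝒪⟦T⟧}ⁿ` vanish in the quotient.
[folklore] -/
theorem mk_mem_pow_eq_zero {x : MvPowerSeries (Fin m) 𝒪}
    (hx : x ∈ maximalIdeal (MvPowerSeries (Fin m) 𝒪) ^ n) :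
    Ideal.Quotient.mk (pushoutTruncIdeal Θ u n) x = 0 :=
  Ideal.Quotient.eq_zero_iff_mem.mpr (le_sup_right (a := Literature.RingTheory.CompleteLocalRings.pushoutIdeal
    (RingHom.ker Θ) u) hx)

/-- **Transfer of sections**: an `𝒪`-algebra section of `q_u` gives a section of
`𝒪⟦T⟧/(J_u + 𝔪ⁿ) ↠ 𝒪⟦T⟧/(J + 𝔪ⁿ)` (compose with `truncEquiv`). [folklore] -/
theorem exists_section_factor_of_section_quRaw
    (h : ∃ s : (R ⧸ maximalIdeal R ^ n) →ₐ[𝒪]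
        (MvPowerSeries (Fin m) 𝒪 ⧸ pushoutTruncIdeal Θ u n),
      (quRaw Θ hΘ u n).comp s = AlgHom.id 𝒪 _) :
    ∃ s : (MvPowerSeries (Fin m) 𝒪 ⧸ (RingHom.ker Θ ⊔
        maximalIdeal (MvPowerSeries (Fin m) 𝒪) ^ n)) →ₐ[𝒪]
        (MvPowerSeries (Fin m) 𝒪 ⧸ (Literature.RingTheory.CompleteLocalRings.pushoutIdeal
          (RingHom.ker Θ) u ⊔ maximalIdeal (MvPowerSeries (Fin m) 𝒪) ^ n)),
      (Ideal.Quotient.factorₐ 𝒪 (sup_le_sup_right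
        (Literature.RingTheory.CompleteLocalRings.pushoutIdeal_le (RingHom.ker Θ) u)
          (maximalIdeal (MvPowerSeries (Fin m) 𝒪) ^ n))).comp s = AlgHom.id 𝒪 _ := by
  obtain ⟨s, hs⟩ := h
  refine ⟨s.comp (truncEquiv Θ hΘ n : _ →ₐ[𝒪] _), ?_⟩
  apply AlgHom.ext
  intro x
  have hx := AlgHom.congr_fun hs (truncEquiv Θ hΘ n x)
  rw [AlgHom.comp_apply, AlgHom.id_apply] at hx
  -- `hx : truncEquiv (factorₐ (s (e x))) = e x`
  have hx' : truncEquiv Θ hΘ n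
      (Ideal.Quotient.factorₐ 𝒪 (I := pushoutTruncIdeal Θ u n)
        (J := RingHom.ker Θ ⊔ maximalIdeal (MvPowerSeries (Fin m) 𝒪) ^ n)
        (pushoutTruncIdeal_le Θ u n) (s (truncEquiv Θ hΘ n x))) =
      truncEquiv Θ hΘ n x := hx
  exact (truncEquiv Θ hΘ n).injective hx'

end Pushout

section PushoutCNL

variable (F : Type) [Field F] [NumberField F] (p : ℕ) (𝒪 : Type) [CommRing 𝒪] [IsDomain 𝒪]
  [IsDiscreteValuationRing 𝒪] [IsAdicComplete (maximalIdeal 𝒪) 𝒪] (k : Type) [Field k]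
  [Algebra 𝒪 k] (𝒟 : NearlyOrdinaryDatum F p 𝒪 k) (𝓡 : NearlyOrdinaryDeformationRing.{0} 𝒟)
  {m : ℕ} (Θ : MvPowerSeries (Fin m) 𝒪 →ₐ[𝒪] 𝓡.R) (hΘ : Function.Surjective Θ)
  (u : Module.Dual (MvPowerSeries (Fin m) 𝒪 ⧸ maximalIdeal (MvPowerSeries (Fin m) 𝒪))
    (↥(RingHom.ker Θ) ⧸
      (maximalIdeal (MvPowerSeries (Fin m) 𝒪) •
        (⊤ : Submodule (MvPowerSeries (Fin m) 𝒪) ↥(RingHom.ker Θ)))))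
  (n : ℕ) (hn0 : n ≠ 0)

/-- **`B_u = 𝒪⟦T⟧/(J_u + 𝔪ⁿ)` as an object of `Ĉ_𝒪(k)`** (`n ≠ 0`).
[cite: Mazur1989Deforming, §1.6 Prop. 2] -/
def Bu : Deformation.CNLAlgebra 𝒪 k :=
  (mvPowerSeriesCNL 𝒪 k 𝒟.residueMap_surjective m).quotient
    (pushoutTruncIdeal Θ u n) (pushoutTruncIdeal_ne_top Θ u n hn0)

/-- The underlying type of `B_u`. [folklore] -/
theorem Bu_carrier :
    ((Bu F p 𝒪 k 𝒟 𝓡 Θ u n hn0 : Deformation.CNLAlgebra 𝒪 k) : Type) =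
      (MvPowerSeries (Fin m) 𝒪 ⧸ pushoutTruncIdeal Θ u n) :=
  rfl

/-- **The surjection `q_u : B_u ↠ R_𝒟/𝔪ⁿ`.** [cite: Mazur1989Deforming, §1.6 Prop. 2] -/
def qu : Bu F p 𝒪 k 𝒟 𝓡 Θ u n hn0 →ₐ[𝒪] 𝓡.R ⧸ maximalIdeal 𝓡.R ^ n :=
  quRaw Θ hΘ u n

/-- `q_u` is onto. [folklore] -/
theorem qu_surjective : Function.Surjective (qu F p 𝒪 k 𝒟 𝓡 Θ hΘ u n hn0) :=
  quRaw_surjective Θ hΘ u n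

/-- **`ker q_u` has square zero.** [cite: Mazur1989Deforming, §1.6 Prop. 2] -/
theorem ker_qu_sqZero :
    ∀ x ∈ RingHom.ker (qu F p 𝒪 k 𝒟 𝓡 Θ hΘ u n hn0 : Bu F p 𝒪 k 𝒟 𝓡 Θ u n hn0 →+*
        𝓡.R ⧸ maximalIdeal 𝓡.R ^ n),
      ∀ y ∈ RingHom.ker (qu F p 𝒪 k 𝒟 𝓡 Θ hΘ u n hn0 : Bu F p 𝒪 k 𝒟 𝓡 Θ u n hn0 →+*
        𝓡.R ⧸ maximalIdeal 𝓡.R ^ n), x * y = 0 :=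
  fun x hx y hy => quRaw_sqZero Θ hΘ u n hn0 x y hx hy

/-- **`𝔪_{B_u}ⁿ⁺¹ = 0`.** [folklore] -/
theorem maximalIdeal_Bu_pow_eq_bot :
    maximalIdeal (Bu F p 𝒪 k 𝒟 𝓡 Θ u n hn0) ^ n = ⊥ := by
  let mkB : MvPowerSeries (Fin m) 𝒪 →+* Bu F p 𝒪 k 𝒟 𝓡 Θ u n hn0 :=
    Ideal.Quotient.mk (pushoutTruncIdeal Θ u n)
  have hloc : maximalIdeal (Bu F p 𝒪 k 𝒟 𝓡 Θ u n hn0) =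
      (maximalIdeal (MvPowerSeries (Fin m) 𝒪)).map mkB :=
    (IsLocalRing.map_maximalIdeal_of_surjective (S := Bu F p 𝒪 k 𝒟 𝓡 Θ u n hn0) mkB
      Ideal.Quotient.mk_surjective).symm
  rw [hloc, ← Ideal.map_pow, eq_bot_iff, Ideal.map_le_iff_le_comap]
  intro x hx
  rw [Ideal.mem_comap, Ideal.mem_bot]
  exact mk_mem_pow_eq_zero Θ u n hx

/-- **Transfer of sections** for `q_u : B_u → R_𝒟/𝔪ⁿ`. [folklore] -/
theorem exists_section_factor_of_section_qu
    (h : ∃ s : (𝓡.R ⧸ maximalIdeal 𝓡.R ^ n) →ₐ[𝒪] Bu F p 𝒪 k 𝒟 𝓡 Θ u n hn0,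
      (qu F p 𝒪 k 𝒟 𝓡 Θ hΘ u n hn0).comp s = AlgHom.id 𝒪 _) :
    ∃ s : (MvPowerSeries (Fin m) 𝒪 ⧸ (RingHom.ker Θ ⊔
        maximalIdeal (MvPowerSeries (Fin m) 𝒪) ^ n)) →ₐ[𝒪]
        (MvPowerSeries (Fin m) 𝒪 ⧸ (Literature.RingTheory.CompleteLocalRings.pushoutIdeal
          (RingHom.ker Θ) u ⊔ maximalIdeal (MvPowerSeries (Fin m) 𝒪) ^ n)),
      (Ideal.Quotient.factorₐ 𝒪 (sup_le_sup_right
        (Literature.RingTheory.CompleteLocalRings.pushoutIdeal_le (RingHom.ker Θ) u)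
          (maximalIdeal (MvPowerSeries (Fin m) 𝒪) ^ n))).comp s = AlgHom.id 𝒪 _ :=
  exists_section_factor_of_section_quRaw Θ hΘ u n h

end PushoutCNL

/-! ## 4. The record from Galois lifts -/

section Record

variable (F : Type) [Field F] [NumberField F] (p : ℕ) (𝒪 : Type) [CommRing 𝒪] [IsDomain 𝒪]
  [IsDiscreteValuationRing 𝒪] [IsAdicComplete (maximalIdeal 𝒪) 𝒪] (k : Type) [Field k]
  [Algebra 𝒪 k] (𝒟 : NearlyOrdinaryDatum F p 𝒪 k) (𝓡 : NearlyOrdinaryDeformationRing.{0} 𝒟)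

set_option quotPrecheck false in
/-- `h = dim_k t_{R_𝒟}` (local notation, as in `NearlyOrdinaryPresentationProofs`). -/
local notation "hR" => ((maximalIdeal (NearlyOrdinaryDeformationRing.R 𝓡)).map
  (Ideal.Quotient.mk ((maximalIdeal 𝒪).map
    (algebraMap 𝒪 (NearlyOrdinaryDeformationRing.R 𝓡))))).spanFinrank

set_option quotPrecheck false in
/-- `𝒪⟦T₁, …, T_h⟧` (local notation). -/
local notation "PR" => MvPowerSeries (Fin hR) 𝒪

/-- **`NearlyOrdinaryPresentation` for `𝓡` from Galois lifts.**  Suppose that for every minimal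
cotangent presentation `Θ : 𝒪⟦T₁, …, T_h⟧ ↠ R_𝒟` and every `n` with `J ∩ 𝔪ⁿ ⊆ 𝔪J`, `n ≥ 2`
(`J = ker Θ`) there are a finite-dimensional `κ`-space `O` with `dim O + 1 + [F:ℚ] ≤ h` and a
`κ`-linear `ob` on `(J/𝔪J)^*` such that `ob u = 0` produces (1) a lift `ρ_B : Γ_F → GL₂(B_u)` of
`ρ_𝒟 mod 𝔪ⁿ` along `q_u` with open kernel, unramified outside `S`, and (2) at each `v ∣ p` an
upper-triangular lift `ρ_v` of `localModPow v n`, a lift `P` of `noFrame v mod 𝔪ⁿ`, a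
section `s'` of `GL₂(q_u)`, a `𝔟(I)`-valued cochain `e` and `X ∈ M₂(I)` splitting the difference
cocycle of `ρ_v` and `P⁻¹ ρ_B|_{Γ_{F_v}} P` up to the coboundary of `X` (the outputs of the
vanishing of the global, local and secondary obstruction classes).  Then the record
`NearlyOrdinaryPresentation` holds for `𝓡`: by `exists_frame_of_secondary'`,
`exists_section_of_lift` (universality) and
`exists_section_factor_of_section_qu` the small extension `B_u ↠ R_𝒟/𝔪ⁿ` splits, and
`nearlyOrdinaryPresentation_of_obstruction` (Mazur's count + the regular presentation) concludes.
[cite: Bockle2007Presentations, Theorem 7.6] [cite: Mazur1989Deforming, §1.6 Prop. 2] -/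
theorem nearlyOrdinaryPresentation_of_lifts
    (hlift : ∀ Θ : PR →ₐ[𝒪] 𝓡.R, (hΘ : Function.Surjective Θ) →
      RingHom.ker Θ ≤ maximalIdeal PR ^ 2 ⊔ (maximalIdeal 𝒪).map (algebraMap 𝒪 PR) →
      ∀ n : ℕ, (hn0 : n ≠ 0) → 2 ≤ n →
        RingHom.ker Θ ⊓ maximalIdeal PR ^ n ≤ maximalIdeal PR * RingHom.ker Θ →
      ∃ (O : Type) (_ : AddCommGroup O) (_ : Module (PR ⧸ maximalIdeal PR) O)
        (_ : Module.Finite (PR ⧸ maximalIdeal PR) O)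
        (ob : Module.Dual (PR ⧸ maximalIdeal PR)
            (↥(RingHom.ker Θ) ⧸ (maximalIdeal PR • (⊤ : Submodule PR ↥(RingHom.ker Θ)))) →ₗ[PR ⧸
              maximalIdeal PR] O),
        (∀ u, ob u = 0 →
          ∃ ρB : absoluteGaloisGroup F →* GL (Fin 2) (Bu F p 𝒪 k 𝒟 𝓡 Θ u n hn0),
            (∀ σ, Matrix.GeneralLinearGroup.map
              (qu F p 𝒪 k 𝒟 𝓡 Θ hΘ u n hn0 : Bu F p 𝒪 k 𝒟 𝓡 Θ u n hn0 →+*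
                𝓡.R ⧸ maximalIdeal 𝓡.R ^ n) (ρB σ) = 𝓡.modPow n σ) ∧
            IsOpen ((ρB.ker : Subgroup (absoluteGaloisGroup F)) : Set (absoluteGaloisGroup F)) ∧
            (∀ v ∉ 𝒟.S, Deformation.IsUnramifiedAt v ρB) ∧
            ∀ v : HeightOneSpectrum (𝓞 F), (p : 𝓞 F) ∈ v.asIdeal →
              ∃ (P : GL (Fin 2) (Bu F p 𝒪 k 𝒟 𝓡 Θ u n hn0))
                (_ : Matrix.GeneralLinearGroup.map
                  (qu F p 𝒪 k 𝒟 𝓡 Θ hΘ u n hn0 : Bu F p 𝒪 k 𝒟 𝓡 Θ u n hn0 →+*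
                    𝓡.R ⧸ maximalIdeal 𝓡.R ^ n) P = 𝓡.noFrameModPow v n)
                (s' : GL (Fin 2) (𝓡.R ⧸ maximalIdeal 𝓡.R ^ n) →
                  GL (Fin 2) (Bu F p 𝒪 k 𝒟 𝓡 Θ u n hn0))
                (_ : ∀ g, Matrix.GeneralLinearGroup.map
                  (qu F p 𝒪 k 𝒟 𝓡 Θ hΘ u n hn0 : Bu F p 𝒪 k 𝒟 𝓡 Θ u n hn0 →+*
                    𝓡.R ⧸ maximalIdeal 𝓡.R ^ n) (s' g) = g)
                (ρv : absoluteGaloisGroup (v.adicCompletion F) →* GL (Fin 2) (Bu F p 𝒪 k 𝒟 𝓡 Θ u n hn0))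
                (e : absoluteGaloisGroup (v.adicCompletion F) →
                  Matrix (Fin 2) (Fin 2) (Bu F p 𝒪 k 𝒟 𝓡 Θ u n hn0))
                (X : Matrix (Fin 2) (Fin 2) (Bu F p 𝒪 k 𝒟 𝓡 Θ u n hn0)),
                (∀ σ, Matrix.GeneralLinearGroup.map
                  (qu F p 𝒪 k 𝒟 𝓡 Θ hΘ u n hn0 : Bu F p 𝒪 k 𝒟 𝓡 Θ u n hn0 →+*
                    𝓡.R ⧸ maximalIdeal 𝓡.R ^ n) (ρv σ) = 𝓡.localModPow v n σ) ∧
                (∀ σ, (ρv σ : Matrix (Fin 2) (Fin 2) (Bu F p 𝒪 k 𝒟 𝓡 Θ u n hn0)) 1 0 = 0) ∧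
                (∀ σ, e σ ∈ LiftingObstruction.kerParabolic (id : Fin 2 → Fin 2)
                  (qu F p 𝒪 k 𝒟 𝓡 Θ hΘ u n hn0 : Bu F p 𝒪 k 𝒟 𝓡 Θ u n hn0 →+*
                    𝓡.R ⧸ maximalIdeal 𝓡.R ^ n)) ∧
                X ∈ LiftingObstruction.kerMatrix
                  (qu F p 𝒪 k 𝒟 𝓡 Θ hΘ u n hn0 : Bu F p 𝒪 k 𝒟 𝓡 Θ u n hn0 →+*
                    𝓡.R ⧸ maximalIdeal 𝓡.R ^ n) ∧
                ∀ σ, LiftingObstruction.liftDiff ρv (NearlyOrdinaryDeformationRing.conjLocal P ρB v) σ =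
                  e σ + (X - (s' (𝓡.localModPow v n σ) :
                      Matrix (Fin 2) (Fin 2) (Bu F p 𝒪 k 𝒟 𝓡 Θ u n hn0)) * X *
                    ((s' (𝓡.localModPow v n σ))⁻¹ : GL (Fin 2) (Bu F p 𝒪 k 𝒟 𝓡 Θ u n hn0)))) ∧
        Module.finrank (PR ⧸ maximalIdeal PR) O + 1 + Module.finrank ℚ F ≤ hR) :
    ∃ (A : Type) (_ : CommRing A) (_ : IsNoetherianRing A) (_ : IsLocalRing A)
      (_ : IsAdicComplete (maximalIdeal A) A) (_ : Algebra 𝒪 A) (n : ℕ)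
      (_ : A ≃ₐ[𝒪] MvPowerSeries (Fin n) 𝒪) (rs : List A) (I : Ideal A) (_ : 𝓡.R ≃ₐ[𝒪] A ⧸ I),
      Ideal.ofList rs = maximalIdeal A ∧ RingTheory.Sequence.IsRegular A rs ∧
        rs.length = n + 1 ∧ (rs.length : WithBot ℕ∞) = ringKrullDim A ∧
        I.spanFinrank + 1 + Module.finrank ℚ F ≤ n := by
  refine nearlyOrdinaryPresentation_of_obstruction F p 𝒪 k 𝒟 𝓡 fun Θ hΘ hmin n hn hJn => ?_
  have hn0 : n ≠ 0 := (Nat.lt_of_lt_of_le Nat.zero_lt_two hn).ne'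
  -- (`have` + `rcases` rather than `obtain … := application`: keeps elaboration cheap)
  have h1 := hlift Θ hΘ hmin n hn0 hn hJn
  rcases h1 with ⟨O, i1, i2, i3, ob, hob, hdim⟩
  refine ⟨O, i1, i2, i3, ob, fun u hu => ?_, hdim⟩
  have h2 := hob u hu
  rcases h2 with ⟨ρB, hρB, hopen, hur, hsec⟩
  refine exists_section_factor_of_section_qu F p 𝒪 k 𝒟 𝓡 Θ hΘ u n hn0 ?_
  refine 𝓡.exists_section_of_lift hn0 (Bu F p 𝒪 k 𝒟 𝓡 Θ u n hn0)
    (qu F p 𝒪 k 𝒟 𝓡 Θ hΘ u n hn0) ρB hρB hopen hur (fun v hv => ?_)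
    (maximalIdeal_Bu_pow_eq_bot F p 𝒪 k 𝒟 𝓡 Θ u n hn0)
  have h3 := hsec v hv
  rcases h3 with ⟨P, hP, s', hs', ρv, e, X, hρv, hρvup, he, hX, hd⟩
  exact 𝓡.exists_frame_of_secondary' (ker_qu_sqZero F p 𝒪 k 𝒟 𝓡 Θ hΘ u n hn0) v P hP hs' ρB ρv
    hρv hρvup e he X hX hd

end Record

end NearlyOrdinaryPresentationCA

end Literature.NumberTheory.GaloisRepresentations
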